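import Summits.RiemannHypothesis.RiemannHypothesis.Theorems.SpectralTraceWindowStepStubRealZeroDensityOfLogIntAux
import HarnessLib

/-!
# Sharp upper density of the real zeros of an entire function of exponential type, II:
# averaged Jensen and the density bound
# (crux `WindowStep`, line `split-birth`, registered stub `stub_realZeroDensityOfLogInt`)

Support file for the crux `stmt-RiemannHypothesis-14659`
(`Summit.RiemannHypothesis.RiemannHypothesis.Theses.SpectralTrace.WindowStep`), line `split-birth`,
registered stub `stub_realZeroDensityOfLogInt` (pure complex analysis, RH-free).

**Theorem (`stub_realZeroDensityOfLogInt`).** Let `F` be entire with `‖F z‖ ≤ K e^{B |Im z|}`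
(`K ≥ 1`, `B ≥ 0`), `F c ≠ 0` for some real `c`, and `∫ log⁺(1/|F(x)|) dx/(1+x²) < ∞`. Then for
every `η > 0` there is `r₀` such that every finite set of real zeros of `F` in `[-r, r]`, `r ≥ r₀`,
has at most `(2B/π + η) r` elements — the upper half of the Levinson–Cartwright theorem (Boas,
*Entire Functions*, Thm 8.4.16) for REAL zeros, by an elementary route.

**Proof (averaged Jensen).** By part I (`sum_posLog_le_of_expType`), for every real `x₀` with
`F x₀ ≠ 0`: `Σ_{λ ∈ Z} log⁺(R/|λ − x₀|) ≤ log K + 2BR/π + log⁺(1/|F x₀|)`. Integrating `x₀` over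
`[-r-R, r+R]` (the exceptional `x₀` form a finite set), each real zero `λ ∈ [-r, r]` collects
`∫_{-R}^{R} log⁺(R/|s|) ds = 2R`, whence
`2R · #Z ≤ 2(r+R)(log K + 2BR/π) + ∫_{-r-R}^{r+R} log⁺(1/|F|)` (§3). With `R = εr` the last integral
is `o(r²)`: it is at most `C(X) + (1 + (r+R)²) T(X)` where `T(X) = ∫ w − ∫_{-X}^{X} w → 0`,
`w = log⁺(1/|F|)/(1+x²)` (§4), and the bookkeeping of §5 gives `#Z ≤ (2B/π + η) r`.
-/

set_option linter.dupNamespace false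

noncomputable section

open Complex Set Filter MeasureTheory Metric Real intervalIntegral
open scoped Topology

namespace Summit.RiemannHypothesis.RiemannHypothesis.Theorems.SpectralTraceWindowStep

open Summit.RiemannHypothesis.RiemannHypothesis.Theorems.WeilWindowFlowStrictUnderRH

variable {F : ℂ → ℂ} {K B : ℝ}

/-! ## §3 Averaging along the real axis -/

/-- The real zeros of an entire `F ≢ 0` in a bounded real interval form a finite set (they carry
positive divisor on a closed disc, whose support is finite). [folklore] -/
theorem finite_real_zeros (hF : Differentiable ℂ F) {c : ℝ} (hc : F (c : ℂ) ≠ 0) (ρ : ℝ) :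
    {x : ℝ | F (x : ℂ) = 0 ∧ |x| ≤ ρ}.Finite := by
  set CB : Set ℂ := closedBall (0 : ℂ) |ρ| with hCB
  set D := MeromorphicOn.divisor F CB with hD
  have hDfin : (Function.support D).Finite := D.finiteSupport (isCompact_closedBall _ _)
  have hsub : {x : ℝ | F (x : ℂ) = 0 ∧ |x| ≤ ρ} ⊆ (fun x : ℝ => (x : ℂ)) ⁻¹' Function.support D := by
    rintro x ⟨hx0, hxρ⟩
    have hmem : (x : ℂ) ∈ CB := by
      rw [hCB, mem_closedBall, dist_zero_right, Complex.norm_real, Real.norm_eq_abs]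
      exact hxρ.trans (le_abs_self ρ)
    have h1 : (1 : ℤ) ≤ D (x : ℂ) := one_le_divisor_of_zero hF hc hmem hx0
    simp only [mem_preimage, Function.mem_support]
    intro h
    rw [h] at h1
    exact absurd h1 (by norm_num)
  exact (hDfin.preimage Complex.ofReal_injective.injOn).subset hsub

/-- **The averaged Jensen inequality.** For `F` entire with `‖F z‖ ≤ K e^{B|Im z|}`, `F ≢ 0` on `ℝ`,
`log⁺(1/|F|)` locally integrable on `ℝ`, `r ≥ 0`, `R > 0`, and a finite set `Z` of real zeros in
`[-r, r]`: `2R · #Z ≤ 2(r+R)(log K + 2BR/π) + ∫_{-r-R}^{r+R} log⁺(1/|F(x)|) dx` — integrate §2 over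
`x₀ ∈ [-r-R, r+R]` (off the finitely many real zeros there); every `λ ∈ Z` collects
`∫_{λ-R}^{λ+R} log⁺(R/|λ − x₀|) dx₀ = 2R`. [folklore] -/
theorem card_mul_le_integral_posLog (hF : Differentiable ℂ F) (hK : 1 ≤ K) (hB : 0 ≤ B)
    (hbd : ∀ z : ℂ, ‖F z‖ ≤ K * Real.exp (B * |z.im|)) {c : ℝ} (hc : F (c : ℂ) ≠ 0)
    (hli : ∀ a b : ℝ, IntervalIntegrable (fun x : ℝ => Real.posLog ‖F (x : ℂ)‖⁻¹) volume a b)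
    {r R : ℝ} (hr : 0 ≤ r) (hR : 0 < R) (Z : Finset ℝ)
    (hZ : ∀ x ∈ Z, |x| ≤ r ∧ F (x : ℂ) = 0) :
    2 * R * Z.card ≤ 2 * (r + R) * (Real.log K + 2 * B * R / π) +
      ∫ x in (-(r + R))..(r + R), Real.posLog ‖F (x : ℂ)‖⁻¹ := by
  set a : ℝ := -(r + R) with ha
  set b : ℝ := r + R with hb
  have hab : a ≤ b := by rw [ha, hb]; linarith
  set f : ℝ → ℝ := fun x₀ => ∑ l ∈ Z, Real.posLog (R / |l - x₀|) with hf
  set g : ℝ → ℝ := fun x₀ => Real.log K + 2 * B * R / π + Real.posLog ‖F (x₀ : ℂ)‖⁻¹ with hg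
  have hf_int : IntervalIntegrable f volume a b := by
    have h := IntervalIntegrable.sum Z (fun l _ => intervalIntegrable_posLog_div_abs_sub R l a b)
    refine h.congr ?_
    intro x _
    simp [hf, Finset.sum_apply]
  have hg_int : IntervalIntegrable g volume a b := intervalIntegrable_const.add (hli a b)
  -- the inequality of §2 holds off the finitely many real zeros in `[a, b]`
  have hfin := finite_real_zeros hF hc b
  have hae : f ≤ᵐ[volume.restrict (Icc a b)] g := by
    have hN : volume {x : ℝ | F (x : ℂ) = 0 ∧ |x| ≤ b} = 0 := hfin.measure_zero volume
    rw [Filter.EventuallyLE, ae_restrict_iff' measurableSet_Icc, ae_iff]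
    refine measure_mono_null ?_ hN
    intro x hx
    simp only [mem_setOf_eq, Classical.not_imp, not_le] at hx
    obtain ⟨hxI, hlt⟩ := hx
    refine ⟨?_, ?_⟩
    · by_contra hx0
      exact (not_le.2 hlt)
        (sum_posLog_le_of_expType hF hK hB hbd hx0 hR Z fun l hl => (hZ l hl).2)
    · rw [ha] at hxI
      exact abs_le.2 ⟨hxI.1, hxI.2⟩
  have hmono := intervalIntegral.integral_mono_ae_restrict hab hf_int hg_int hae
  -- lower bound: every zero collects `2R`
  have hlow : 2 * R * Z.card ≤ ∫ x in a..b, f x := by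
    have hsplit : ∫ x in a..b, f x = ∑ l ∈ Z, ∫ x in a..b, Real.posLog (R / |l - x|) :=
      intervalIntegral.integral_finsetSum fun l _ => intervalIntegrable_posLog_div_abs_sub R l a b
    rw [hsplit]
    have hterm : ∀ l ∈ Z, 2 * R ≤ ∫ x in a..b, Real.posLog (R / |l - x|) := by
      intro l hl
      have hl' := abs_le.1 (hZ l hl).1
      have hla : a ≤ l - R := by rw [ha]; linarith [hl'.1]
      have hlb : l + R ≤ b := by rw [hb]; linarith [hl'.2]
      have e1 : l - (l + R) = -R := by ring
      have e2 : l - (l - R) = R := by ring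
      calc 2 * R = ∫ s in (-R)..R, Real.posLog (R / |s|) := (integral_posLog_div_abs hR).symm
        _ = ∫ x in (l - R)..(l + R), Real.posLog (R / |l - x|) := by
            rw [intervalIntegral.integral_comp_sub_left (fun s => Real.posLog (R / |s|)) l, e1, e2]
        _ ≤ ∫ x in a..b, Real.posLog (R / |l - x|) :=
            intervalIntegral.integral_mono_interval hla (by linarith) hlb
              (Filter.Eventually.of_forall fun x => posLog_nonneg)
              (intervalIntegrable_posLog_div_abs_sub R l a b)
    calc 2 * R * Z.card = ∑ l ∈ Z, 2 * R := by rw [Finset.sum_const, nsmul_eq_mul]; ring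
      _ ≤ ∑ l ∈ Z, ∫ x in a..b, Real.posLog (R / |l - x|) := Finset.sum_le_sum hterm
  -- the right-hand side integrates to the stated bound
  have hg_val : ∫ x in a..b, g x = 2 * (r + R) * (Real.log K + 2 * B * R / π) +
      ∫ x in a..b, Real.posLog ‖F (x : ℂ)‖⁻¹ := by
    rw [hg, intervalIntegral.integral_add intervalIntegrable_const (hli a b),
      intervalIntegral.integral_const, ha, hb]
    simp only [smul_eq_mul]
    ring
  linarith


/-! ## §4 Local integrability and the tail of `∫ log⁺(1/|F|) dx/(1+x²)` -/

/-- `x ↦ log⁺(1/|F(x)|)` is measurable for continuous `F`. [folklore] -/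
theorem measurable_posLog_inv_norm (hF : Continuous F) :
    Measurable fun x : ℝ => Real.posLog ‖F (x : ℂ)‖⁻¹ :=
  continuous_posLog.measurable.comp
    ((continuous_norm.measurable.comp (hF.measurable.comp Complex.continuous_ofReal.measurable)).inv)

/-- Poisson integrability of `log⁺(1/|F|)` gives its integrability on every bounded interval
(the weight `1/(1+x²)` is bounded below there). [folklore] -/
theorem intervalIntegrable_posLog_inv_norm (hF : Continuous F)
    (hint : Integrable (fun x : ℝ => Real.posLog ‖F (x : ℂ)‖⁻¹ / (1 + x ^ 2))) (a b : ℝ) :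
    IntervalIntegrable (fun x : ℝ => Real.posLog ‖F (x : ℂ)‖⁻¹) volume a b := by
  set M : ℝ := max |a| |b| with hM
  have hg : IntervalIntegrable (fun x : ℝ => (1 + M ^ 2) * (Real.posLog ‖F (x : ℂ)‖⁻¹ / (1 + x ^ 2)))
      volume a b :=
    (hint.const_mul (1 + M ^ 2)).intervalIntegrable
  refine hg.mono_fun' (measurable_posLog_inv_norm hF).aestronglyMeasurable ?_
  rw [Filter.EventuallyLE, ae_restrict_iff' measurableSet_uIoc]
  refine Filter.Eventually.of_forall fun x hx => ?_
  have hxM : |x| ≤ M := by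
    have hx' : x ∈ uIcc a b := uIoc_subset_uIcc hx
    rw [mem_uIcc] at hx'
    rcases hx' with ⟨h1, h2⟩ | ⟨h1, h2⟩
    · exact (abs_le_max_abs_abs h1 h2).trans (le_of_eq hM.symm)
    · exact (abs_le_max_abs_abs h1 h2).trans (by rw [hM, max_comm])
  have hx2 : x ^ 2 ≤ M ^ 2 := by
    have := sq_abs x
    nlinarith [abs_nonneg x]
  have hpos : 0 < 1 + x ^ 2 := by positivity
  have hnn : 0 ≤ Real.posLog ‖F (x : ℂ)‖⁻¹ := posLog_nonneg
  rw [Real.norm_eq_abs, abs_of_nonneg hnn]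
  rw [mul_div_assoc', le_div_iff₀ hpos]
  nlinarith

/-- **Tail bound.** With `T(X) = ∫ w − ∫_{-X}^{X} w` (`w = log⁺(1/|F|)/(1+x²)`) and
`C(X) = ∫_{-X}^{X} log⁺(1/|F|)`: for `0 ≤ X ≤ ρ`,
`∫_{-ρ}^{ρ} log⁺(1/|F|) ≤ C(X) + (1 + ρ²) T(X)`. [folklore] -/
theorem integral_posLog_inv_norm_le_tail (hF : Continuous F)
    (hint : Integrable (fun x : ℝ => Real.posLog ‖F (x : ℂ)‖⁻¹ / (1 + x ^ 2))) {X ρ : ℝ}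
    (hX : 0 ≤ X) (hXρ : X ≤ ρ) :
    ∫ x in (-ρ)..ρ, Real.posLog ‖F (x : ℂ)‖⁻¹ ≤
      (∫ x in (-X)..X, Real.posLog ‖F (x : ℂ)‖⁻¹) +
        (1 + ρ ^ 2) * ((∫ x : ℝ, Real.posLog ‖F (x : ℂ)‖⁻¹ / (1 + x ^ 2)) -
          ∫ x in (-X)..X, Real.posLog ‖F (x : ℂ)‖⁻¹ / (1 + x ^ 2)) := by
  set h : ℝ → ℝ := fun x => Real.posLog ‖F (x : ℂ)‖⁻¹ with hh
  set w : ℝ → ℝ := fun x => Real.posLog ‖F (x : ℂ)‖⁻¹ / (1 + x ^ 2) with hw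
  have hli := intervalIntegrable_posLog_inv_norm hF hint
  have hwi : ∀ a b : ℝ, IntervalIntegrable w volume a b := fun a b => hint.intervalIntegrable
  have hw0 : ∀ x, 0 ≤ w x := fun x => div_nonneg posLog_nonneg (by positivity)
  have hhw : ∀ x, h x = (1 + x ^ 2) * w x := fun x => by
    have : 0 < 1 + x ^ 2 := by positivity
    simp only [hh, hw]
    rw [mul_div_cancel₀ _ this.ne']
  -- split `[-ρ, ρ] = [-ρ, -X] ∪ [-X, X] ∪ [X, ρ]`
  have hsplit : ∫ x in (-ρ)..ρ, h x =
      (∫ x in (-ρ)..(-X), h x) + (∫ x in (-X)..X, h x) + ∫ x in X..ρ, h x := by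
    rw [intervalIntegral.integral_add_adjacent_intervals (hli _ _) (hli _ _),
      intervalIntegral.integral_add_adjacent_intervals (hli _ _) (hli _ _)]
  have hwsplit : ∫ x in (-ρ)..ρ, w x =
      (∫ x in (-ρ)..(-X), w x) + (∫ x in (-X)..X, w x) + ∫ x in X..ρ, w x := by
    rw [intervalIntegral.integral_add_adjacent_intervals (hwi _ _) (hwi _ _),
      intervalIntegral.integral_add_adjacent_intervals (hwi _ _) (hwi _ _)]
  -- on the outer pieces `h ≤ (1 + ρ²) w`
  have hright : ∫ x in X..ρ, h x ≤ (1 + ρ ^ 2) * ∫ x in X..ρ, w x := by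
    rw [← intervalIntegral.integral_const_mul]
    refine intervalIntegral.integral_mono_on hXρ (hli _ _) ((hwi _ _).const_mul _) fun x hx => ?_
    rw [hhw x]
    have : x ^ 2 ≤ ρ ^ 2 := by nlinarith [hx.1, hx.2]
    nlinarith [hw0 x]
  have hleft : ∫ x in (-ρ)..(-X), h x ≤ (1 + ρ ^ 2) * ∫ x in (-ρ)..(-X), w x := by
    rw [← intervalIntegral.integral_const_mul]
    refine intervalIntegral.integral_mono_on (by linarith) (hli _ _) ((hwi _ _).const_mul _)
      fun x hx => ?_
    rw [hhw x]
    have : x ^ 2 ≤ ρ ^ 2 := by nlinarith [hx.1, hx.2]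
    nlinarith [hw0 x]
  -- `∫_{-ρ}^{ρ} w ≤ ∫ w`
  have hwhole : ∫ x in (-ρ)..ρ, w x ≤ ∫ x, w x := by
    rw [intervalIntegral.integral_of_le (by linarith)]
    exact setIntegral_le_integral hint (Filter.Eventually.of_forall hw0)
  have hρ2 : 0 ≤ 1 + ρ ^ 2 := by positivity
  rw [hsplit]
  have key : (∫ x in (-ρ)..(-X), w x) + ∫ x in X..ρ, w x ≤
      (∫ x, w x) - ∫ x in (-X)..X, w x := by linarith
  nlinarith [mul_le_mul_of_nonneg_left key hρ2]


/-! ## §5 The registered stub -/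

/-- The choice of the Jensen radius ratio: `ε = min 1 (πη/(8(B+1)))` has `(2B/π) ε ≤ η/4`. [folklore] -/
theorem eps_choice_le {B η : ℝ} (hB : 0 ≤ B) (hη : 0 < η) :
    2 * B / π * min 1 (π * η / (8 * (B + 1))) ≤ η / 4 := by
  have hπ := pi_pos
  have h1 : min 1 (π * η / (8 * (B + 1))) ≤ π * η / (8 * (B + 1)) := min_le_right _ _
  have h0 : 0 ≤ 2 * B / π := by positivity
  calc 2 * B / π * min 1 (π * η / (8 * (B + 1)))
      ≤ 2 * B / π * (π * η / (8 * (B + 1))) := mul_le_mul_of_nonneg_left h1 h0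
    _ = B / (B + 1) * (η / 4) := by field_simp; ring
    _ ≤ 1 * (η / 4) := by
        apply mul_le_mul_of_nonneg_right _ (by positivity)
        rw [div_le_one (by positivity)]
        linarith
    _ = η / 4 := one_mul _

/-- **`stub_realZeroDensityOfLogInt` (crux `WindowStep`, line `split-birth`, v2 stub 4b).** For an
entire `F` with `‖F z‖ ≤ K e^{B |Im z|}` (`K ≥ 1`, `B ≥ 0`), `F c ≠ 0` for some real `c`, and
`∫ log⁺(1/|F(x)|) dx/(1+x²) < ∞`, the REAL zeros have upper density `≤ 2B/π`: for every `η > 0`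
there is `r₀` such that every finite set of real zeros in `[-r, r]`, `r ≥ r₀`, has at most
`(2B/π + η) r` elements. Proof: §3 with `R = εr`, `ε = min 1 (πη/(8(B+1)))`, and §4 with `X` so
large that the tail `T(X) ≤ εη/8`; then `r₀ = max (max X 1) (2(2(1+ε) log K + C(X))/(εη))`.
(Upper half, for real zeros, of the Levinson–Cartwright theorem.) [folklore; cf. Boas 1954,
Entire Functions, Thm 8.4.16] -/
theorem stub_realZeroDensityOfLogInt :
    ∀ (F : ℂ → ℂ) (K B : ℝ), Differentiable ℂ F → 1 ≤ K → 0 ≤ B →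
      (∀ z : ℂ, ‖F z‖ ≤ K * Real.exp (B * |z.im|)) → (∃ c : ℝ, F (c : ℂ) ≠ 0) →
        MeasureTheory.Integrable (fun x : ℝ => Real.posLog ‖F (x : ℂ)‖⁻¹ / (1 + x ^ 2)) →
          ∀ η : ℝ, 0 < η → ∃ r₀ : ℝ, ∀ r : ℝ, r₀ ≤ r → ∀ Z : Finset ℝ,
            (∀ x ∈ Z, |x| ≤ r ∧ F (x : ℂ) = 0) → (Z.card : ℝ) ≤ (2 * B / Real.pi + η) * r := by
  intro F K B hF hK hB hbd hc hint η hη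
  obtain ⟨c, hc⟩ := hc
  have hFc : Continuous F := hF.continuous
  have hli := intervalIntegrable_posLog_inv_norm hFc hint
  have hπ := pi_pos
  -- the tail `T(X) = ∫ w − ∫_{-X}^{X} w → 0`
  have hTlim : Tendsto (fun X : ℝ => (∫ x : ℝ, Real.posLog ‖F (x : ℂ)‖⁻¹ / (1 + x ^ 2)) -
      ∫ x in (-X)..X, Real.posLog ‖F (x : ℂ)‖⁻¹ / (1 + x ^ 2)) atTop (𝓝 0) := by
    have h := intervalIntegral_tendsto_integral hint tendsto_neg_atTop_atBot tendsto_id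
    have := (tendsto_const_nhds
      (x := ∫ x : ℝ, Real.posLog ‖F (x : ℂ)‖⁻¹ / (1 + x ^ 2))).sub h
    rw [sub_self] at this
    exact this
  -- constants
  set ε : ℝ := min 1 (π * η / (8 * (B + 1))) with hε
  have hε0 : 0 < ε := lt_min one_pos (by positivity)
  have hε1 : ε ≤ 1 := min_le_left _ _
  have hεB : 2 * B / π * ε ≤ η / 4 := eps_choice_le hB hη
  have hev : ∀ᶠ X in atTop, ((∫ x : ℝ, Real.posLog ‖F (x : ℂ)‖⁻¹ / (1 + x ^ 2)) -
      ∫ x in (-X)..X, Real.posLog ‖F (x : ℂ)‖⁻¹ / (1 + x ^ 2)) ≤ ε * η / 8 ∧ 0 ≤ X :=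
    (((tendsto_order.1 hTlim).2 _ (by positivity)).mono fun X h => h.le).and
      (eventually_ge_atTop 0)
  obtain ⟨X, hTX, hX0⟩ := hev.exists
  set t : ℝ := (∫ x : ℝ, Real.posLog ‖F (x : ℂ)‖⁻¹ / (1 + x ^ 2)) -
      ∫ x in (-X)..X, Real.posLog ‖F (x : ℂ)‖⁻¹ / (1 + x ^ 2) with ht
  set CX : ℝ := ∫ x in (-X)..X, Real.posLog ‖F (x : ℂ)‖⁻¹ with hCX
  have hCX0 : 0 ≤ CX := intervalIntegral.integral_nonneg (by linarith) fun x _ => posLog_nonneg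
  have hlogK : 0 ≤ Real.log K := Real.log_nonneg hK
  set L : ℝ := Real.log K with hL
  refine ⟨max (max X 1) (2 * (2 * (1 + ε) * L + CX) / (ε * η)), fun r hr Z hZ => ?_⟩
  have hrX : X ≤ r := ((le_max_left _ _).trans (le_max_left _ _)).trans hr
  have hr1 : 1 ≤ r := ((le_max_right _ _).trans (le_max_left _ _)).trans hr
  have hrQ : 2 * (2 * (1 + ε) * L + CX) / (ε * η) ≤ r := (le_max_right _ _).trans hr
  have hr0 : 0 < r := by linarith
  set R : ℝ := ε * r with hR
  have hR0 : 0 < R := mul_pos hε0 hr0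
  have hRr : R ≤ r := by rw [hR]; nlinarith
  -- §3 and §4
  have h3 := card_mul_le_integral_posLog hF hK hB hbd hc hli hr0.le hR0 Z hZ
  have hρ : X ≤ r + R := by linarith
  have h4 := integral_posLog_inv_norm_le_tail hFc hint hX0 hρ
  have hmain : 2 * R * Z.card ≤
      2 * (r + R) * (L + 2 * B * R / π) + CX + (1 + (r + R) ^ 2) * t := by
    linarith
  -- bookkeeping
  have hexp : 2 * (r + R) * (L + 2 * B * R / π) =
      2 * (1 + ε) * r * L + 4 * B * ε * r ^ 2 / π + 4 * B * ε ^ 2 * r ^ 2 / π := by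
    rw [hR]; ring
  have step1 : 4 * B * ε ^ 2 * r ^ 2 / π ≤ ε * η * r ^ 2 / 2 := by
    have h := mul_le_mul_of_nonneg_left hεB (by positivity : (0 : ℝ) ≤ 2 * ε * r ^ 2)
    calc 4 * B * ε ^ 2 * r ^ 2 / π = 2 * ε * r ^ 2 * (2 * B / π * ε) := by ring
      _ ≤ 2 * ε * r ^ 2 * (η / 4) := h
      _ = ε * η * r ^ 2 / 2 := by ring
  have step2 : (1 + (r + R) ^ 2) * t ≤ 5 / 8 * (ε * η * r ^ 2) := by
    have hpos : (0 : ℝ) ≤ 5 / 8 * (ε * η * r ^ 2) := by positivity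
    rcases le_or_gt 0 t with ht0 | ht0
    · have hcoef : 1 + (r + R) ^ 2 ≤ 5 * r ^ 2 := by nlinarith
      calc (1 + (r + R) ^ 2) * t ≤ 5 * r ^ 2 * t := mul_le_mul_of_nonneg_right hcoef ht0
        _ ≤ 5 * r ^ 2 * (ε * η / 8) := mul_le_mul_of_nonneg_left hTX (by positivity)
        _ = 5 / 8 * (ε * η * r ^ 2) := by ring
    · have : (1 + (r + R) ^ 2) * t ≤ 0 :=
        mul_nonpos_iff.2 (Or.inl ⟨by positivity, ht0.le⟩)
      linarith
  have step3 : 2 * (1 + ε) * r * L + CX ≤ ε * η * r ^ 2 / 2 := by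
    have h1 : 2 * (2 * (1 + ε) * L + CX) ≤ r * (ε * η) := by
      rwa [div_le_iff₀ (by positivity)] at hrQ
    have h2 : CX ≤ r * CX := le_mul_of_one_le_left hCX0 hr1
    have h3' : r * (2 * (1 + ε) * L + CX) ≤ r * (ε * η * r / 2) :=
      mul_le_mul_of_nonneg_left (by linarith) hr0.le
    nlinarith
  have hfinal : 2 * R * Z.card ≤ 2 * R * ((2 * B / π + η) * r) := by
    have e : 2 * R * ((2 * B / π + η) * r) = 4 * B * ε * r ^ 2 / π + 2 * (ε * η * r ^ 2) := by
      rw [hR]; ring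
    rw [e]
    have hεηr : 0 ≤ ε * η * r ^ 2 := by positivity
    linarith
  exact le_of_mul_le_mul_left hfinal (by positivity)


end Summit.RiemannHypothesis.RiemannHypothesis.Theorems.SpectralTraceWindowStep

end
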